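import Mathlib
import Summits.Ventures.HodgeRepro.Tier4.Common.AdicResidue

/-!
# Tier4/Common/CongruenceAdeles — the congruence sets `∏_v N·𝓞_v` of the finite adele ring: open, closed, compact,
and a NEIGHBOURHOOD BASIS of `0` (the Mathlib-side half of the WANTED-COMMON «compact open subgroups of `G(𝔸_f)` as a
neighbourhood basis of `1`», t4-plan-1 S13521 (2) / t4-L1-p3 S13483 (c))

Blind re-derivation cell `pub-hodge-repro`, Tier 4 (README §9–§10), seat t4-typer-2 (gen 2).  Target tree path
`lean/Summits/Ventures/HodgeRepro/Tier4/Common/CongruenceAdeles.lean`.  Mathlib + `Tier4/Common/AdicResidue.lean`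
(`compactSpace_adicCompletionIntegers`).

For a natural number `N ≠ 0`, **`modSet k N := {x ∈ 𝔸_{k,f} | ∀ v, |x_v|_v ≤ |N|_v}`** (`x_v ∈ N·𝓞_v` at every finite
place; `= 𝓞_v` at the places not dividing `N`).  PROVED: `modSet_subset_integral` (`⊆ ∏_v 𝓞_v`), `isOpen_modSet`
(the places dividing `N` are finitely many — `Ideal.finite_factors` — and a closed ball of non-zero radius is open in
`k_v`), `isClosed_modSet`, `isCompact_integral` (`∏_v 𝓞_v` is the image of the compact product `Π v, 𝓞_v` —
Tychonoff on AdicResidue's `CompactSpace (𝓞_v)` — under the continuous structure map), `isCompact_modSet`, and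
**`exists_modSet_subset_nhds_zero : ∀ U ∈ 𝓝 (0 : 𝔸_{k,f}), ∃ N : ℕ, N ≠ 0 ∧ modSet k N ⊆ U`** (the restricted-product
neighbourhoods of `0` are the images of product neighbourhoods of `0` in `Π v, 𝓞_v` — Mathlib's
`RestrictedProduct.nhds_eq_map_structureMap` — which contain finite boxes of `v`-adic balls; a power of the absolute
norm of each of the finitely many places involved gives `N`).  The group side (`K(N) ≤ G(𝔸_f)` compact open, a basis
of `1` in `G(𝔸)`) is the next module.

Nothing here says anything about the status of the Hodge conjecture for CM abelian varieties, which is NOT proved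
(HC_CM is NOT proved by anyone in this repository).
-/

set_option autoImplicit false

noncomputable section

namespace Summit.Ventures.HodgeRepro.Tier4.Common

open NumberField IsDedekindDomain Topology Filter Set
open scoped NumberField

section ValueGroup

/-- In `ℤᵐ⁰`, a non-zero `a < 1` has powers below any non-zero `γ`. -/
theorem exists_pow_lt_of_lt_one' {a γ : WithZero (Multiplicative ℤ)} (ha0 : a ≠ 0) (ha : a < 1) (hγ : γ ≠ 0) :
    ∃ n : ℕ, a ^ n < γ := by
  obtain ⟨u, rfl⟩ := WithZero.ne_zero_iff_exists.1 ha0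
  obtain ⟨w, rfl⟩ := WithZero.ne_zero_iff_exists.1 hγ
  have hu : u < 1 := by
    rw [← WithZero.coe_one, WithZero.coe_lt_coe] at ha
    exact ha
  obtain ⟨n, hn⟩ := exists_pow_lt hu w
  exact ⟨n, by rw [← WithZero.coe_pow, WithZero.coe_lt_coe]; exact hn⟩

end ValueGroup

section Congruence

variable (k : Type) [Field k] [NumberField k]

/-- The `v`-adic size of a natural number, read in `k_v`. -/
def natSize (v : HeightOneSpectrum (𝓞 k)) (N : ℕ) : WithZero (Multiplicative ℤ) :=
  Valued.v ((N : k) : v.adicCompletion k)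

/-- `|N|_v ≤ 1`. -/
theorem natSize_le_one (v : HeightOneSpectrum (𝓞 k)) (N : ℕ) : natSize k v N ≤ 1 := by
  unfold natSize
  rw [HeightOneSpectrum.valuedAdicCompletion_eq_valuation' v (N : k)]
  have := HeightOneSpectrum.valuation_le_one (K := k) v (N : 𝓞 k)
  simpa using this

/-- `|N|_v ≠ 0` for `N ≠ 0`. -/
theorem natSize_ne_zero (v : HeightOneSpectrum (𝓞 k)) {N : ℕ} (hN : N ≠ 0) : natSize k v N ≠ 0 := by
  unfold natSize
  rw [HeightOneSpectrum.valuedAdicCompletion_eq_valuation' v (N : k), (Valuation.ne_zero_iff _)]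
  exact Nat.cast_ne_zero.2 hN

/-- `|N|_v` is multiplicative. -/
theorem natSize_mul (v : HeightOneSpectrum (𝓞 k)) (M N : ℕ) :
    natSize k v (M * N) = natSize k v M * natSize k v N := by
  unfold natSize
  rw [HeightOneSpectrum.valuedAdicCompletion_eq_valuation' v, HeightOneSpectrum.valuedAdicCompletion_eq_valuation' v,
    HeightOneSpectrum.valuedAdicCompletion_eq_valuation' v, Nat.cast_mul, Valuation.map_mul]

/-- `|N ^ n|_v = |N|_v ^ n`. -/
theorem natSize_pow (v : HeightOneSpectrum (𝓞 k)) (N n : ℕ) : natSize k v (N ^ n) = natSize k v N ^ n := by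
  unfold natSize
  rw [HeightOneSpectrum.valuedAdicCompletion_eq_valuation' v, HeightOneSpectrum.valuedAdicCompletion_eq_valuation' v,
    Nat.cast_pow, Valuation.map_pow]

/-- The places dividing `N` (`|N|_v < 1`) are finitely many (`N ≠ 0`). -/
theorem finite_natSize_lt_one {N : ℕ} (hN : N ≠ 0) : {v : HeightOneSpectrum (𝓞 k) | natSize k v N < 1}.Finite := by
  have h : {v : HeightOneSpectrum (𝓞 k) | natSize k v N < 1} ⊆
      {v : HeightOneSpectrum (𝓞 k) | v.asIdeal ∣ Ideal.span {(N : 𝓞 k)}} := by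
    intro v hv
    simp only [Set.mem_setOf_eq] at hv ⊢
    rw [← HeightOneSpectrum.valuation_lt_one_iff_dvd (K := k)]
    unfold natSize at hv
    rw [HeightOneSpectrum.valuedAdicCompletion_eq_valuation' v (N : k)] at hv
    simpa using hv
  refine (Ideal.finite_factors ?_).subset h
  rw [Ne, Submodule.zero_eq_bot, Ideal.span_singleton_eq_bot]
  exact Nat.cast_ne_zero.2 hN

/-- **The congruence set `∏_v N·𝓞_v ⊆ 𝔸_{k,f}`.** -/
def modSet (N : ℕ) : Set (FiniteAdeleRing (𝓞 k) k) :=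
  {x | ∀ v : HeightOneSpectrum (𝓞 k), Valued.v (x v) ≤ natSize k v N}

/-- The integral finite adeles `∏_v 𝓞_v`. -/
def integralSet : Set (FiniteAdeleRing (𝓞 k) k) :=
  {x | ∀ v : HeightOneSpectrum (𝓞 k), x v ∈ v.adicCompletionIntegers k}

/-- `modSet N ⊆ ∏_v 𝓞_v`. -/
theorem modSet_subset_integral (N : ℕ) : modSet k N ⊆ integralSet k := fun _ hx v =>
  (HeightOneSpectrum.mem_adicCompletionIntegers (𝓞 k) k v).2 ((hx v).trans (natSize_le_one k v N))

/-- `modSet` is antitone along divisibility: `M ∣ N ⇒ modSet N ⊆ modSet M`. -/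
theorem modSet_antitone {M N : ℕ} (h : M ∣ N) : modSet k N ⊆ modSet k M := by
  obtain ⟨c, rfl⟩ := h
  intro _ hx v
  refine (hx v).trans ?_
  rw [natSize_mul]
  calc natSize k v M * natSize k v c ≤ natSize k v M * 1 := mul_le_mul_right (natSize_le_one k v c) _
    _ = natSize k v M := mul_one _

/-- The closed ball of radius `|N|_v` in `k_v` is `N · 𝓞_v`. -/
theorem closedBall_eq_image (v : HeightOneSpectrum (𝓞 k)) {N : ℕ} (hN : N ≠ 0) :
    {y : v.adicCompletion k | Valued.v y ≤ natSize k v N} =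
      (fun z : v.adicCompletion k => ((N : k) : v.adicCompletion k) * z) '' (v.adicCompletionIntegers k : Set _) := by
  have hN' : ((N : k) : v.adicCompletion k) ≠ 0 := by
    intro h0
    have := natSize_ne_zero k v hN
    unfold natSize at this
    rw [h0, Valuation.map_zero] at this
    exact this rfl
  ext y
  constructor
  · intro hy
    refine ⟨y / ((N : k) : v.adicCompletion k), ?_, by field_simp⟩
    show Valued.v (y / _) ≤ 1
    rw [Valuation.map_div]
    exact div_le_one₀ (zero_lt_iff.2 (natSize_ne_zero k v hN)) |>.2 hy
  · rintro ⟨z, hz, rfl⟩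
    show Valued.v (_ * z) ≤ natSize k v N
    rw [Valuation.map_mul]
    calc natSize k v N * Valued.v z ≤ natSize k v N * 1 := mul_le_mul_right hz _
      _ = natSize k v N := mul_one _

/-- The closed ball of radius `|N|_v ≠ 0` is open in `k_v`. -/
theorem isOpen_closedBallN (v : HeightOneSpectrum (𝓞 k)) {N : ℕ} (hN : N ≠ 0) :
    IsOpen {y : v.adicCompletion k | Valued.v y ≤ natSize k v N} := by
  rw [closedBall_eq_image k v hN]
  have hN' : ((N : k) : v.adicCompletion k) ≠ 0 := by
    intro h0
    have := natSize_ne_zero k v hN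
    unfold natSize at this
    rw [h0, Valuation.map_zero] at this
    exact this rfl
  exact (Homeomorph.mulLeft₀ _ hN').isOpenMap _ (Valued.isOpen_valuationSubring (v.adicCompletion k))

/-- The closed ball of radius `|N|_v ≠ 0` is closed in `k_v`. -/
theorem isClosed_closedBallN (v : HeightOneSpectrum (𝓞 k)) {N : ℕ} (hN : N ≠ 0) :
    IsClosed {y : v.adicCompletion k | Valued.v y ≤ natSize k v N} := by
  rw [closedBall_eq_image k v hN]
  have hN' : ((N : k) : v.adicCompletion k) ≠ 0 := by
    intro h0
    have := natSize_ne_zero k v hN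
    unfold natSize at this
    rw [h0, Valuation.map_zero] at this
    exact this rfl
  exact (Homeomorph.mulLeft₀ _ hN').isClosedMap _ (Valued.isClosed_valuationSubring (v.adicCompletion k))

/-- The components of a finite adele are continuous functions of it. -/
theorem continuous_component (v : HeightOneSpectrum (𝓞 k)) :
    Continuous fun x : FiniteAdeleRing (𝓞 k) k => x v :=
  RestrictedProduct.continuous_eval v

/-- `∏_v 𝓞_v` is open (Mathlib: the restricted-product topology). -/
theorem isOpen_integralSet : IsOpen (integralSet k) :=
  RestrictedProduct.isOpen_forall_mem
    (fun v : HeightOneSpectrum (𝓞 k) => Valued.isOpen_valuationSubring (v.adicCompletion k))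

/-- **`modSet N` is open** (`N ≠ 0`): it is `∏_v 𝓞_v` cut down at the finitely many places dividing `N` by closed balls
of non-zero radius, which are open. -/
theorem isOpen_modSet {N : ℕ} (hN : N ≠ 0) : IsOpen (modSet k N) := by
  have hset : modSet k N = integralSet k ∩
      ⋂ v ∈ {v : HeightOneSpectrum (𝓞 k) | natSize k v N < 1},
        (fun x : FiniteAdeleRing (𝓞 k) k => x v) ⁻¹' {y | Valued.v y ≤ natSize k v N} := by
    ext x
    constructor
    · intro hx
      refine ⟨modSet_subset_integral k N hx, ?_⟩
      simp only [Set.mem_iInter, Set.mem_preimage, Set.mem_setOf_eq]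
      intro v _
      exact hx v
    · rintro ⟨hint, hx⟩ v
      simp only [Set.mem_iInter, Set.mem_preimage, Set.mem_setOf_eq] at hx
      by_cases hv : natSize k v N < 1
      · exact hx v hv
      · have h1 : natSize k v N = 1 := le_antisymm (natSize_le_one k v N) (not_lt.1 hv)
        rw [h1]
        exact (HeightOneSpectrum.mem_adicCompletionIntegers (𝓞 k) k v).1 (hint v)
  rw [hset]
  refine (isOpen_integralSet k).inter ?_
  refine (finite_natSize_lt_one k hN).isOpen_biInter fun v _ => ?_
  exact (isOpen_closedBallN k v hN).preimage (continuous_component k v)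

/-- `modSet N` is closed (`N ≠ 0`). -/
theorem isClosed_modSet {N : ℕ} (hN : N ≠ 0) : IsClosed (modSet k N) := by
  have hset : modSet k N = ⋂ v : HeightOneSpectrum (𝓞 k),
      (fun x : FiniteAdeleRing (𝓞 k) k => x v) ⁻¹' {y | Valued.v y ≤ natSize k v N} := by
    ext x
    simp only [modSet, Set.mem_setOf_eq, Set.mem_iInter, Set.mem_preimage]
  rw [hset]
  exact isClosed_iInter fun v => (isClosed_closedBallN k v hN).preimage (continuous_component k v)

/-- The structure map `Π v, 𝓞_v → 𝔸_{k,f}`. -/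
def structMap : (∀ v : HeightOneSpectrum (𝓞 k), v.adicCompletionIntegers k) → FiniteAdeleRing (𝓞 k) k :=
  RestrictedProduct.structureMap (fun v : HeightOneSpectrum (𝓞 k) => v.adicCompletion k)
    (fun v => (v.adicCompletionIntegers k : Set (v.adicCompletion k))) Filter.cofinite

/-- The structure map is continuous. -/
theorem continuous_structMap : Continuous (structMap k) :=
  RestrictedProduct.isEmbedding_structureMap.continuous

/-- `∏_v 𝓞_v` is the range of the structure map. -/
theorem integralSet_eq_range : integralSet k = Set.range (structMap k) := by
  ext x
  constructor
  · intro hx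
    exact ⟨fun v => ⟨x v, hx v⟩, by ext v; rfl⟩
  · rintro ⟨y, rfl⟩ v
    exact (y v).2

/-- **`∏_v 𝓞_v` is compact**: the continuous image of the compact product `Π v, 𝓞_v` (Tychonoff on AdicResidue's
`CompactSpace (𝓞_v)`). -/
theorem isCompact_integralSet : IsCompact (integralSet k) := by
  rw [integralSet_eq_range]
  haveI : ∀ v : HeightOneSpectrum (𝓞 k), CompactSpace (v.adicCompletionIntegers k) :=
    fun v => compactSpace_adicCompletionIntegers k v
  exact isCompact_range (continuous_structMap k)

/-- **`modSet N` is compact.** -/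
theorem isCompact_modSet {N : ℕ} (hN : N ≠ 0) : IsCompact (modSet k N) :=
  (isCompact_integralSet k).of_isClosed_subset (isClosed_modSet k hN) (modSet_subset_integral k N)

end Congruence

/-! ## v0.2 (append): the congruence sets are a NEIGHBOURHOOD BASIS of `0` in `𝔸_{k,f}`

`𝓝 (0 : 𝔸_{k,f})` is the image of `𝓝 (0 : Π v, 𝓞_v)` under the structure map (Mathlib's
`RestrictedProduct.nhds_eq_map_structureMap`, `∏_v 𝓞_v` being open); a neighbourhood of `0` in the product contains
a finite box `I.pi t` of neighbourhoods of `0` in the `𝓞_v` (`nhds_pi`, `Filter.mem_pi`), each containing an open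
ball `{v(y) < γ_v}` (`Valued.mem_nhds_zero`); a power of the absolute norm of `v.asIdeal` (which lies in `v.asIdeal`,
`Ideal.absNorm_mem`) has `v`-adic size below `γ_v` (`exists_pow_lt_of_lt_one'`), and the product `N` of these powers
over the finitely many `v ∈ I` gives `modSet k N ⊆ U` (`modSet_antitone` along divisibility). -/

section Basis

variable (k : Type) [Field k] [NumberField k]

/-- `|N|_v ≤ |M|_v` when `M ∣ N`. -/
theorem natSize_le_of_dvd (v : HeightOneSpectrum (𝓞 k)) {M N : ℕ} (h : M ∣ N) : natSize k v N ≤ natSize k v M := by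
  obtain ⟨c, rfl⟩ := h
  rw [natSize_mul]
  calc natSize k v M * natSize k v c ≤ natSize k v M * 1 := mul_le_mul_right (natSize_le_one k v c) _
    _ = natSize k v M := mul_one _

/-- The absolute norm of `v.asIdeal` has `v`-adic size `< 1`. -/
theorem natSize_absNorm_lt_one (v : HeightOneSpectrum (𝓞 k)) : natSize k v (Ideal.absNorm v.asIdeal) < 1 := by
  unfold natSize
  rw [HeightOneSpectrum.valuedAdicCompletion_eq_valuation' v]
  have h1 : ((Ideal.absNorm v.asIdeal : ℕ) : k) = algebraMap (𝓞 k) k ((Ideal.absNorm v.asIdeal : ℕ) : 𝓞 k) := by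
    simp
  rw [h1, HeightOneSpectrum.valuation_lt_one_iff_dvd, Ideal.dvd_span_singleton]
  exact Ideal.absNorm_mem v.asIdeal

/-- The absolute norm of `v.asIdeal` is non-zero. -/
theorem absNorm_asIdeal_ne_zero (v : HeightOneSpectrum (𝓞 k)) : Ideal.absNorm v.asIdeal ≠ 0 := by
  rw [Ne, Ideal.absNorm_eq_zero_iff]
  exact v.ne_bot

/-- **Below every non-zero `γ` there is a natural number of `v`-adic size `< γ`** (a power of the absolute norm). -/
theorem exists_natSize_lt (v : HeightOneSpectrum (𝓞 k)) {γ : WithZero (Multiplicative ℤ)} (hγ : γ ≠ 0) :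
    ∃ N : ℕ, N ≠ 0 ∧ natSize k v N < γ := by
  obtain ⟨n, hn⟩ := exists_pow_lt_of_lt_one' (natSize_ne_zero k v (absNorm_asIdeal_ne_zero k v))
    (natSize_absNorm_lt_one k v) hγ
  exact ⟨Ideal.absNorm v.asIdeal ^ n, pow_ne_zero _ (absNorm_asIdeal_ne_zero k v), by rw [natSize_pow]; exact hn⟩

/-- A neighbourhood of `0` in `𝓞_v` contains the closed ball of radius `|N|_v` for some `N ≠ 0`. -/
theorem exists_natSize_ball_subset (v : HeightOneSpectrum (𝓞 k)) {t : Set (v.adicCompletionIntegers k)}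
    (ht : t ∈ 𝓝 (0 : v.adicCompletionIntegers k)) :
    ∃ N : ℕ, N ≠ 0 ∧ ∀ y : v.adicCompletionIntegers k, Valued.v (y : v.adicCompletion k) ≤ natSize k v N → y ∈ t := by
  rw [nhds_subtype, Filter.mem_comap] at ht
  obtain ⟨s, hs, hst⟩ := ht
  obtain ⟨γ, hγ⟩ := Valued.mem_nhds_zero.1 hs
  have hγ0 : MonoidWithZeroHom.ValueGroup₀.embedding (γ.1) ≠ 0 :=
    MonoidWithZeroHom.ValueGroup₀.embedding_unit_ne_zero γ
  obtain ⟨N, hN, hlt⟩ := exists_natSize_lt k v hγ0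
  refine ⟨N, hN, fun y hy => hst ?_⟩
  apply hγ
  show (Valued.v).restrict (y : v.adicCompletion k) < γ.1
  rw [← MonoidWithZeroHom.ValueGroup₀.embedding_strictMono.lt_iff_lt, Valuation.embedding_restrict]
  exact lt_of_le_of_lt hy hlt

/-- `0` is the structure map of `0`. -/
theorem structMap_zero : structMap k 0 = 0 := by
  ext v
  rfl

/-- **The congruence sets form a neighbourhood basis of `0` in `𝔸_{k,f}`**: every `U ∈ 𝓝 0` contains `modSet k N`
for some `N ≠ 0`. -/
theorem exists_modSet_subset_nhds_zero {U : Set (FiniteAdeleRing (𝓞 k) k)}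
    (hU : U ∈ 𝓝 (0 : FiniteAdeleRing (𝓞 k) k)) : ∃ N : ℕ, N ≠ 0 ∧ modSet k N ⊆ U := by
  have hAopen : ∀ v : HeightOneSpectrum (𝓞 k), IsOpen (v.adicCompletionIntegers k : Set (v.adicCompletion k)) :=
    fun v => Valued.isOpen_valuationSubring (v.adicCompletion k)
  have hmap := RestrictedProduct.nhds_eq_map_structureMap hAopen (0 : ∀ v : HeightOneSpectrum (𝓞 k),
    v.adicCompletionIntegers k)
  have hU' : structMap k ⁻¹' U ∈ 𝓝 (0 : ∀ v : HeightOneSpectrum (𝓞 k), v.adicCompletionIntegers k) := by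
    have h1 : U ∈ 𝓝 (structMap k 0) := by rw [structMap_zero]; exact hU
    unfold structMap at h1 ⊢
    erw [hmap, Filter.mem_map] at h1
    exact h1
  rw [nhds_pi, Filter.mem_pi] at hU'
  obtain ⟨I, hI, t, ht, hsub⟩ := hU'
  choose Nf hNf using fun v => exists_natSize_ball_subset k v (ht v)
  refine ⟨∏ v ∈ hI.toFinset, Nf v, Finset.prod_ne_zero_iff.2 fun v _ => (hNf v).1, ?_⟩
  intro x hx
  have hxint : x ∈ Set.range (structMap k) := by
    rw [← integralSet_eq_range]
    exact modSet_subset_integral k _ hx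
  obtain ⟨y, rfl⟩ := hxint
  apply hsub
  intro v hv
  apply (hNf v).2
  have hdvd : Nf v ∣ ∏ w ∈ hI.toFinset, Nf w := Finset.dvd_prod_of_mem _ (hI.mem_toFinset.2 hv)
  exact (hx v).trans (natSize_le_of_dvd k v hdvd)

end Basis

end Summit.Ventures.HodgeRepro.Tier4.Common

end
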